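import Literature.Analysis.FluidPDE.SereginSverak2002CaseB
import Literature.Analysis.FluidPDE.SereginSverak2002TopReduction
import HarnessLib

/-!
# Seregin–Šverák 2002: after the pressure-floor case, the fact reduces to the head-bounded case

Analysis/FluidPDE proofs file (theorems only; no definition, no named fact, no `sorry`) on the
discharge path of the named fact `Literature.Analysis.FluidPDE.SereginSverak2002_pressureOneSidedBound`
(`SereginSverak2002PressureLowerBound.lean`; G. Seregin, V. Šverák, *Navier–Stokes equations
with lower bounds on the pressure*, Arch. Ration. Mech. Anal. **163** (2002) 65–86, Thm. 2.2 with
the constant majorant `g ≡ M`). The fact has two alternative one-sided hypotheses on `(0, T) × ℝ³`: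
(b) the pressure floor `p̃ ≥ -M` and (a) the head ceiling `|u|² + 2p̃ ≤ M` (p. 66 of the paper:
"our method also gives a proof of the following statement … If the quantity `|u|²+2p` is
bounded from above, the solution must be regular"). Case (b) is now a theorem of the tree,
`SereginSverak2002.isBackwardBoundedAt_of_floor` (`SereginSverak2002CaseB.lean`: the blow-up limit
at a top point vanishes weakly at the final time — finite log-tangential energy, radial zoom
limits — its zero extension is suitable across `t = 0`, and Caffarelli–Kohn–Nirenberg forbids the
concentration). This file records what is therefore left:

* `SereginSverak2002.pressureOneSidedBound_floorCase` — alternative (b) of the fact, for every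
  viscosity and every `t₀ ∈ (0, T]` (a repackaging of `isBackwardBoundedAt_of_floor` in the
  fact's binder order);
* `SereginSverak2002_pressureOneSidedBound.of_headCase` — **the reduction**: the fact follows from
  its alternative (a) alone, and already from (a) at unit viscosity and at top points `(T, x₀)`
  (viscosity by `of_unitViscosity`, interior times by continuity of the classical solution);
* `SereginSverak2002_pressureOneSidedBound.of_headCase_cknAEss_small` — equivalently, from the
  decay of the scaled energy `A(r; (T, x₀)) → 0` at top points in case (a) only (Lemma 3.3 of the
  paper through `isBackwardBoundedAt_of_cknAEss_le`);
* `SereginSverak2002_pressureOneSidedBound.iff_headCase` — and conversely, so the fact is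
  EQUIVALENT to its head-bounded alternative at `ν = 1` and top points.

## References

* G. Seregin, V. Šverák, Arch. Ration. Mech. Anal. 163 (2002) 65–86: abstract, §1 p. 66, Thm. 2.2.
  [SereginSverak2002]
-/

noncomputable section

open _root_.MeasureTheory Set Function Filter _root_.Topology TopologicalSpace Metric
open scoped NNReal ENNReal

namespace Literature.Analysis.FluidPDE

namespace SereginSverak2002

/-! ## Alternative (b) of the fact is a theorem -/

/-- **Alternative (b) of `SereginSverak2002_pressureOneSidedBound` holds**: under the pressure
floor `p̃ ≥ -M` on `(0, T) × ℝ³`, every `(t₀, x₀)` with `t₀ ∈ (0, T]` is backward bounded, for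
every viscosity `ν > 0` (`isBackwardBoundedAt_of_floor`, in the binder order of the fact; the decay
hypothesis on the datum is not needed). [cite: SereginSverak2002, Thm. 2.2, case p ≥ -g] -/
theorem pressureOneSidedBound_floorCase {ν T : ℝ} (hν : 0 < ν) (hT : 0 < T)
    {u : ℝ → EuclideanSpace ℝ (Fin 3) → EuclideanSpace ℝ (Fin 3)}
    {p : ℝ → EuclideanSpace ℝ (Fin 3) → ℝ}
    (hs : IsClassicalNSSolutionOn (Ico 0 T) ν 0 u p) (hLH : IsLerayHopfOn T ν 0 (u 0) u)
    {M : ℝ} (hM : ∀ t ∈ Ioo 0 T, ∀ x, -M ≤ normalisedPressure (u t) x)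
    {t₀ : ℝ} (ht₀ : t₀ ∈ Ioc 0 T) (x₀ : EuclideanSpace ℝ (Fin 3)) :
    IsBackwardBoundedAt u t₀ x₀ :=
  isBackwardBoundedAt_of_floor hν hT hs hLH hM ht₀ x₀

/-! ## The reduction to the head-bounded alternative -/

/-- **The fact from its head-bounded case at `ν = 1` and top points.** If for every classical
solution `(u, p)` of the unforced Navier–Stokes system with viscosity `1` on `[0, T) × ℝ³` which is
Leray–Hopf on `[0, T)` with smooth rapidly decaying datum and satisfies `|u|² + 2p̃ ≤ M` on
`(0, T) × ℝ³`, every top point `(T, x₀)` is backward bounded, then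
`SereginSverak2002_pressureOneSidedBound` holds: reduce to `ν = 1` (`of_unitViscosity`); the floor
alternative is `isBackwardBoundedAt_of_floor`; in the head alternative interior times are regular
by continuity (`IsBackwardBoundedAt.of_continuousOn`). [cite: SereginSverak2002, §1 p. 66 and Thm. 2.2] -/
theorem _root_.Literature.Analysis.FluidPDE.SereginSverak2002_pressureOneSidedBound.of_headCase
    (h : ∀ (T : ℝ) (u : ℝ → EuclideanSpace ℝ (Fin 3) → EuclideanSpace ℝ (Fin 3))
      (p : ℝ → EuclideanSpace ℝ (Fin 3) → ℝ), 0 < T →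
      IsClassicalNSSolutionOn (Ico 0 T) 1 0 u p → IsLerayHopfOn T 1 0 (u 0) u →
      HasRapidSpatialDecay (u 0) →
      ∀ M : ℝ, (∀ t ∈ Ioo 0 T, ∀ x, ‖u t x‖ ^ 2 + 2 * normalisedPressure (u t) x ≤ M) →
      ∀ x₀ : EuclideanSpace ℝ (Fin 3), IsBackwardBoundedAt u T x₀) :
    SereginSverak2002_pressureOneSidedBound := by
  refine SereginSverak2002_pressureOneSidedBound.of_unitViscosity
    fun T hT u p hs hLH hd hM t₀ ht₀ x₀ => ?_
  obtain ⟨M, hfloor | hhead⟩ := hM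
  · exact isBackwardBoundedAt_of_floor one_pos hT hs hLH hfloor ht₀ x₀
  · rcases ht₀.2.lt_or_eq with hlt | rfl
    · exact IsBackwardBoundedAt.of_continuousOn hs.smooth_velocity.continuousOn ⟨ht₀.1, hlt⟩ x₀
    · exact h t₀ u p hT hs hLH hd M hhead x₀

/-- **The fact from the decay of `A` at top points in the head-bounded case.** It suffices that,
for the `ν = 1` class of the fact under `|u|² + 2p̃ ≤ M`, at every top point `(T, x₀)` and for
every `ε > 0` one has `ess sup_{T-r²<s<T} r⁻¹ ∫_{B_r(x₀)} |u(s)|² ≤ ε` for all small `r`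
(the paper's Lemma 3.3, `isBackwardBoundedAt_of_cknAEss_le`).
[cite: SereginSverak2002, Lemma 3.3 and Thm. 2.2] -/
theorem _root_.Literature.Analysis.FluidPDE.SereginSverak2002_pressureOneSidedBound.of_headCase_cknAEss_small
    (h : ∀ (T : ℝ) (u : ℝ → EuclideanSpace ℝ (Fin 3) → EuclideanSpace ℝ (Fin 3))
      (p : ℝ → EuclideanSpace ℝ (Fin 3) → ℝ), 0 < T →
      IsClassicalNSSolutionOn (Ico 0 T) 1 0 u p → IsLerayHopfOn T 1 0 (u 0) u →
      HasRapidSpatialDecay (u 0) →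
      ∀ M : ℝ, (∀ t ∈ Ioo 0 T, ∀ x, ‖u t x‖ ^ 2 + 2 * normalisedPressure (u t) x ≤ M) →
      ∀ (x₀ : EuclideanSpace ℝ (Fin 3)) (ε : ℝ), 0 < ε →
        ∃ R : ℝ, 0 < R ∧ ∀ r ∈ Ioo 0 R, cknAEss r (T, x₀) u ≤ ENNReal.ofReal ε) :
    SereginSverak2002_pressureOneSidedBound := by
  refine SereginSverak2002_pressureOneSidedBound.of_headCase fun T u p hT hs hLH hd M hhead x₀ => ?_
  obtain ⟨ε, hε, h33⟩ := isBackwardBoundedAt_of_cknAEss_le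
  obtain ⟨R, hR, hA⟩ := h T u p hT hs hLH hd M hhead x₀ ε hε
  exact h33 T u p hT hs hLH x₀ R hR hA

/-- **The equivalence.** `SereginSverak2002_pressureOneSidedBound` holds if and only if its
head-bounded alternative holds at unit viscosity and at top points.
[cite: SereginSverak2002, §1 p. 66 and Thm. 2.2] -/
theorem _root_.Literature.Analysis.FluidPDE.SereginSverak2002_pressureOneSidedBound.iff_headCase :
    SereginSverak2002_pressureOneSidedBound ↔
      ∀ (T : ℝ) (u : ℝ → EuclideanSpace ℝ (Fin 3) → EuclideanSpace ℝ (Fin 3))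
        (p : ℝ → EuclideanSpace ℝ (Fin 3) → ℝ), 0 < T →
        IsClassicalNSSolutionOn (Ico 0 T) 1 0 u p → IsLerayHopfOn T 1 0 (u 0) u →
        HasRapidSpatialDecay (u 0) →
        ∀ M : ℝ, (∀ t ∈ Ioo 0 T, ∀ x, ‖u t x‖ ^ 2 + 2 * normalisedPressure (u t) x ≤ M) →
        ∀ x₀ : EuclideanSpace ℝ (Fin 3), IsBackwardBoundedAt u T x₀ :=
  ⟨fun hfact T u p hT hs hLH hd M hhead x₀ =>
      hfact 1 T one_pos hT u p hs hLH hd ⟨M, Or.inr hhead⟩ T ⟨hT, le_rfl⟩ x₀,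
    SereginSverak2002_pressureOneSidedBound.of_headCase⟩

end SereginSverak2002

end Literature.Analysis.FluidPDE
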